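import Summits.BirchSwinnertonDyer.BirchSwinnertonDyer.Theorems.ResidualThetaTransportAtTwoHeckeThetaPartnerAdicAtTwoThetaLines
import Literature.NumberTheory.ModularForms.BinaryThetaNull
import Mathlib.LinearAlgebra.SymplecticGroup
import HarnessLib

/-!
# Gradient theta nulls on lines: holomorphy and the inversion `τ ↦ -1/τ` (toward K0⁺, stmt-20690)

Route `ResidualThetaTransportAtTwo`, crux K0⁺ `HeckeThetaPartnerAdicAtTwo` (stmt-BirchSwinnertonDyer-20690),
line "Hecke theta series from the genus-two Riemann theta function".  THEOREMS ONLY.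

* `mdifferentiable_fderiv_line` — `τ ↦ ∇_u ϑ[a;b](0, τ·P)` is holomorphic on `ℍ` (locally uniformly
  convergent series of exponentials);
* `fderiv_comp_mulVec_eq_of_law` — differentiating a theta transformation law
  `θ₂(A v) = K e(πi ᵗvNv) θ₁(v)` at `v = 0`: `∇θ₂(0) ∘ A = K ∇θ₁(0)`;
* `fderiv_line_inv` — **the inversion**: for `P, P' ∈ Sym₂(ℚ)` positive definite with `P'P = 1`
  there is a constant `Λ` with
  `∇_u ϑ[-b; a](0, (-1/τ)·P) = Λ τ² ∇_{P'u} ϑ[a; b](0, τ·P')` for all `τ ∈ ℍ`, `u ∈ ℂ²`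
  (the genus-two law for `J = (0 -1; 1 0)`, `J·(τP') = -(τP')⁻¹ = (-1/τ)P`, with the constant
  `C(τP', J) = λ (det P')^{1/2} τ` of `BinaryThetaNull.exists_unit_transform_const_eq_mul`).

BSD is not proved by this file.
-/

set_option autoImplicit false
set_option linter.dupNamespace false

noncomputable section

open scoped Real MatrixGroups UpperHalfPlane Topology Manifold
open Matrix Complex Filter

namespace Summit.BirchSwinnertonDyer.BirchSwinnertonDyer.Theorems.HeckeTheta

open Literature.Analysis.SpecialFunctions
open Literature.NumberTheory.ModularForms.BinaryTheta
open Literature.NumberTheory.Automorphic (siegelUpperHalfSpace mem_siegelUpperHalfSpace_iff)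
open Literature.NumberTheory.ModularForms.SiegelUpperHalfSpace (denom moeb)

/-! ### Holomorphy on `ℍ` -/

/-- The general term on the line is an exponential `e(z K₁ + K₂)` in `z`. -/
theorem riemannThetaCharTerm_line_eq_cexp (P : Matrix (Fin 2) (Fin 2) ℚ) (a b : Fin 2 → ℚ)
    (m : Fin 2 → ℤ) : ∃ K₁ K₂ : ℂ, ∀ z : ℂ,
    riemannThetaCharTerm (fun i => (a i : ℂ)) (fun i => (b i : ℂ)) (z • P.map (Rat.cast : ℚ → ℂ)) 0 m =
      cexp (z * K₁ + K₂) := by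
  refine ⟨π * I * ((((fun i => (m i : ℂ)) + fun i => (a i : ℂ)) ⬝ᵥ
      (P.map (Rat.cast : ℚ → ℂ) *ᵥ ((fun i => (m i : ℂ)) + fun i => (a i : ℂ))))),
    2 * π * I * ((((fun i => (m i : ℂ)) + fun i => (a i : ℂ)) ⬝ᵥ ((0 : Fin 2 → ℂ) + fun i => (b i : ℂ)))),
    fun z => ?_⟩
  rw [riemannThetaCharTerm]
  congr 1
  simp only [dotProduct, mulVec, Fin.sum_univ_two, Matrix.smul_apply, Matrix.map_apply, Pi.add_apply,
    smul_eq_mul]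
  ring

/-- **`τ ↦ ∇_u ϑ[a; b](0, τ·P)` is holomorphic on `ℍ`** (rational data, `P` positive definite). -/
theorem mdifferentiable_fderiv_line {P : Matrix (Fin 2) (Fin 2) ℚ} (hPs : P.IsSymm)
    (hPpos : (P.map (Rat.cast : ℚ → ℝ)).PosDef) (a b : Fin 2 → ℚ) (u : Fin 2 → ℂ) :
    MDifferentiable 𝓘(ℂ) 𝓘(ℂ) (fun τ : ℍ => fderiv ℂ (riemannThetaChar (fun i => (a i : ℂ))
      (fun i => (b i : ℂ)) ((τ : ℂ) • P.map (Rat.cast : ℚ → ℂ))) 0 u) := by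
  rw [UpperHalfPlane.mdifferentiable_iff]
  set F : (Fin 2 → ℤ) → ℂ → ℂ := fun m z =>
    2 * π * I * ((((fun i => (m i : ℂ)) + fun i => (a i : ℂ)) ⬝ᵥ u)) *
      riemannThetaCharTerm (fun i => (a i : ℂ)) (fun i => (b i : ℂ)) (z • P.map (Rat.cast : ℚ → ℂ)) 0 m
    with hF
  set Q : (Fin 2 → ℤ) → ℝ := fun m => ∑ i, ∑ j, ((m i : ℝ) + a i) * (P i j : ℝ) * ((m j : ℝ) + a j) with hQ
  obtain ⟨c, hc, hcQ⟩ := exists_pos_quadForm_ge hPs hPpos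
  have hQnn : ∀ m, 0 ≤ Q m := fun m =>
    le_trans (mul_nonneg hc.le (Finset.sum_nonneg fun i _ => sq_nonneg _)) (hcQ _)
  -- each term is entire
  have hdiffF : ∀ m, Differentiable ℂ (F m) := by
    intro m
    obtain ⟨K₁, K₂, hK⟩ := riemannThetaCharTerm_line_eq_cexp P a b m
    have : F m = fun z => 2 * π * I * ((((fun i => (m i : ℂ)) + fun i => (a i : ℂ)) ⬝ᵥ u)) *
        cexp (z * K₁ + K₂) := by
      funext z; rw [hF]; simp only [hK z]
    rw [this]
    fun_prop
  -- the series on `{Im z > y}`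
  have hdiffy : ∀ y : ℝ, 0 < y → DifferentiableOn ℂ (fun z => ∑' m, F m z) {z : ℂ | y < z.im} := by
    intro y hy
    have hyI : 0 < (((y : ℝ) : ℂ) * I).im := by simp [hy]
    obtain ⟨hsym, c', hc', hY'⟩ := line_hyps hPs hPpos hyI
    have hS := (hasSum_fderiv_riemannThetaChar_apply _ hsym hc' hY' (fun i => (a i : ℂ))
      (fun i => (b i : ℂ)) 0 u).summable.norm
    have hnorm : ∀ m (w : ℂ), ‖F m w‖ =
        ‖2 * π * I * ((((fun i => (m i : ℂ)) + fun i => (a i : ℂ)) ⬝ᵥ u))‖ *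
          Real.exp (-(π * w.im * Q m)) := fun m w => by
      simp only [hF, hQ]
      rw [norm_mul, norm_riemannThetaCharTerm_line]
    refine differentiableOn_tsum_of_summable_norm (u := fun m => ‖F m (((y : ℝ) : ℂ) * I)‖) hS
      (fun m => (hdiffF m).differentiableOn) (isOpen_lt continuous_const Complex.continuous_im)
      fun m z hz => ?_
    rw [hnorm, hnorm]
    refine mul_le_mul_of_nonneg_left ?_ (norm_nonneg _)
    rw [Real.exp_le_exp]
    have hzim : y ≤ z.im := le_of_lt hz
    have him : (((y : ℝ) : ℂ) * I).im = y := by simp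
    rw [him]
    nlinarith [Real.pi_pos, mul_nonneg (sub_nonneg.mpr hzim) (hQnn m)]
  have hdiff : DifferentiableOn ℂ (fun z => ∑' m, F m z) {z : ℂ | 0 < z.im} := by
    intro z hz
    have h := hdiffy (z.im / 2) (by simp only [Set.mem_setOf_eq] at hz; linarith)
    have hzmem : z ∈ {w : ℂ | z.im / 2 < w.im} := by
      simp only [Set.mem_setOf_eq] at hz ⊢; linarith
    exact (h.differentiableAt ((isOpen_lt continuous_const Complex.continuous_im).mem_nhds hzmem)).differentiableWithinAt
  refine hdiff.congr fun z hz => ?_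
  simp only [Set.mem_setOf_eq] at hz
  simp only [Function.comp_apply, UpperHalfPlane.ofComplex_apply_of_im_pos hz]
  obtain ⟨hsym, c', hc', hY'⟩ := line_hyps hPs hPpos (τ := z) hz
  exact ((hasSum_fderiv_riemannThetaChar_apply _ hsym hc' hY' (fun i => (a i : ℂ))
    (fun i => (b i : ℂ)) 0 u).tsum_eq).symm


/-! ### Differentiating a transformation law with a linear change of variable -/

/-- **`∇θ₂(0) ∘ A = K ∇θ₁(0)`** if `θ₂(A v) = K e(πi ᵗvNv) θ₁(v)` for all `v` (`θ₁, θ₂`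
differentiable at `0`); stated on vectors: `∇θ₂(0)(A w) = K ∇θ₁(0)(w)`. -/
theorem fderiv_comp_mulVec_eq_of_law {n : ℕ} {θ₁ θ₂ : (Fin n → ℂ) → ℂ}
    (h₁ : DifferentiableAt ℂ θ₁ 0) (A : Matrix (Fin n) (Fin n) ℂ)
    (h₂ : DifferentiableAt ℂ θ₂ 0) {K : ℂ} (N : Matrix (Fin n) (Fin n) ℂ)
    (hlaw : ∀ v : Fin n → ℂ, θ₂ (A *ᵥ v) = K * cexp (π * I * (v ⬝ᵥ (N *ᵥ v))) * θ₁ v)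
    (w : Fin n → ℂ) :
    fderiv ℂ θ₂ 0 (A *ᵥ w) = K * fderiv ℂ θ₁ 0 w := by
  -- the linear map `v ↦ A v` as a continuous linear map
  set L : (Fin n → ℂ) →L[ℂ] (Fin n → ℂ) := LinearMap.toContinuousLinearMap (Matrix.mulVecLin A) with hL
  have hLapply : ∀ v, L v = A *ᵥ v := fun v => by simp [hL]
  have hL0 : A *ᵥ (0 : Fin n → ℂ) = 0 := Matrix.mulVec_zero _
  -- `θ₂ ∘ A` is differentiable at `0` with derivative `∇θ₂(0) ∘ L`
  have hcomp : HasFDerivAt (fun v => θ₂ (A *ᵥ v)) ((fderiv ℂ θ₂ 0).comp L) 0 := by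
    have h2 : HasFDerivAt θ₂ (fderiv ℂ θ₂ 0) (A *ᵥ 0) := by rw [hL0]; exact h₂.hasFDerivAt
    have h3 : HasFDerivAt (fun v : Fin n → ℂ => A *ᵥ v) L 0 := by
      have hfun : (fun v : Fin n → ℂ => A *ᵥ v) = ⇑L := funext fun v => (hLapply v).symm
      rw [hfun]
      exact L.hasFDerivAt
    exact h2.comp 0 h3
  -- apply the scalar lemma with `w = 1` to `θ₂ ∘ A`
  have hlaw' : ∀ v : Fin n → ℂ, (fun v => θ₂ (A *ᵥ v)) ((1 : ℂ)⁻¹ • v) =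
      K * cexp (π * I * (v ⬝ᵥ (N *ᵥ v))) * θ₁ v := fun v => by
    simp only [inv_one, one_smul]; exact hlaw v
  have h := fderiv_eq_smul_of_transform_law h₁ hcomp.differentiableAt one_ne_zero N hlaw'
  rw [hcomp.fderiv, one_mul] at h
  have hw := congrArg (fun T : (Fin n → ℂ) →L[ℂ] ℂ => T w) h
  simp only [ContinuousLinearMap.comp_apply, hLapply, FunLike.coe_smul, Pi.smul_apply, smul_eq_mul] at hw
  exact hw

/-! ### The inversion `τ ↦ -1/τ` -/

/-- The characteristic map of `J = (0 -1; 1 0)`: `J[a; b] = [-b; a]`. -/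
theorem thetaChar_J (a b : Fin 2 → ℂ) :
    thetaCharFst (Matrix.J (Fin 2) ℤ) a b = -b ∧ thetaCharSnd (Matrix.J (Fin 2) ℤ) a b = a := by
  have hJ : (Matrix.J (Fin 2) ℤ).map ((↑) : ℤ → ℂ) = fromBlocks 0 (-1) 1 0 := by
    rw [Matrix.J, fromBlocks_map]
    simp [Matrix.map_zero Int.cast Int.cast_zero, Matrix.map_one Int.cast Int.cast_zero Int.cast_one,
      Matrix.map_neg]
  constructor
  · rw [thetaCharFst_def, hJ]
    funext i
    fin_cases i <;> simp [Matrix.J, Matrix.toBlocks₂₁, Matrix.toBlocks₂₂, Matrix.mul_apply]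
  · rw [thetaCharSnd_def, hJ]
    funext i
    fin_cases i <;> simp [Matrix.J, Matrix.toBlocks₁₁, Matrix.toBlocks₁₂, Matrix.mul_apply]

/-- **The inversion law for gradient theta nulls on lines.**  `P, P' ∈ Sym₂(ℚ)` positive definite
with `P'P = 1`; then for some constant `Λ` (a unit times `(det P')^{1/2} e(πi k(J, a, b))`):
`∇_u ϑ[-b; a](0, (-1/τ)·P) = Λ τ² ∇_{P'u} ϑ[a; b](0, τ·P')` for all `τ ∈ ℍ`, `u ∈ ℂ²`. -/
theorem fderiv_line_inv {P P' : Matrix (Fin 2) (Fin 2) ℚ} (hPs : P.IsSymm)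
    (hPpos : (P.map (Rat.cast : ℚ → ℝ)).PosDef) (hP's : P'.IsSymm)
    (hP'pos : (P'.map (Rat.cast : ℚ → ℝ)).PosDef) (hPP' : P' * P = 1) (a b : Fin 2 → ℂ) :
    ∃ Λ : ℂ, ∀ τ : ℍ, ∀ u : Fin 2 → ℂ,
      fderiv ℂ (riemannThetaChar (-b) a ((-((τ : ℂ)⁻¹)) • P.map (Rat.cast : ℚ → ℂ))) 0 u =
        Λ * (τ : ℂ) ^ 2 *
          fderiv ℂ (riemannThetaChar a b ((τ : ℂ) • P'.map (Rat.cast : ℚ → ℂ))) 0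
            (P'.map (Rat.cast : ℚ → ℂ) *ᵥ u) := by
  set Q : Matrix (Fin 2) (Fin 2) ℂ := P'.map (Rat.cast : ℚ → ℂ) with hQdef
  set Pc : Matrix (Fin 2) (Fin 2) ℂ := P.map (Rat.cast : ℚ → ℂ) with hPcdef
  have hQP : Q * Pc = 1 := by
    have h := congrArg (fun M : Matrix (Fin 2) (Fin 2) ℚ => M.map (Rat.castHom ℂ : ℚ →+* ℂ)) hPP'
    simp only [Matrix.map_mul] at h
    rw [Matrix.map_one _ (map_zero _) (map_one _)] at h
    exact h
  have hM := SymplecticGroup.J_mem (Fin 2) ℤ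
  have hP : ∀ τ : ℂ, 0 < τ.im → τ • Q ∈ siegelUpperHalfSpace 2 := fun τ hτ =>
    smul_ratCast_mem_siegelUpperHalfSpace hP's hP'pos hτ
  -- the square root of `det P'`
  have hdetpos : 0 < (P'.det : ℝ) := by
    have h := hP'pos.det_pos
    rwa [← Rat.cast_det] at h
  set s : ℝ := Real.sqrt (P'.det : ℝ) with hs
  have hs2 : ((s : ℂ)) ^ 2 = ((P'.det : ℚ) : ℂ) := by
    rw [← Complex.ofReal_pow, hs, Real.sq_sqrt hdetpos.le, Complex.ofReal_ratCast]
  have hs0 : (s : ℂ) ≠ 0 := by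
    rw [Complex.ofReal_ne_zero, hs]; exact (Real.sqrt_pos.mpr hdetpos).ne'
  set ℓ : ℂ → ℂ := fun τ => τ * s with hℓ
  have hℓc : ContinuousOn ℓ {τ : ℂ | 0 < τ.im} := (continuous_id.mul continuous_const).continuousOn
  have hℓ0 : ∀ τ : ℂ, 0 < τ.im → ℓ τ ≠ 0 := fun τ hτ =>
    mul_ne_zero (fun h => by simp [h] at hτ) hs0
  have hdet : ∀ τ : ℂ, 0 < τ.im →
      (denom ((Matrix.J (Fin 2) ℤ).map ((↑) : ℤ → ℂ)) (τ • Q)).det = ℓ τ ^ 2 := by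
    intro τ _
    obtain ⟨hden, -, -⟩ := denom_moeb_J (g := 2) (τ • Q)
    rw [hden, Matrix.det_smul, Fintype.card_fin, hQdef, ← Rat.cast_det, hℓ]
    simp only
    rw [mul_pow, hs2]
  obtain ⟨Λ₀, -, hpin⟩ := exists_unit_transform_const_eq_mul hM hP hℓc hℓ0 hdet
  obtain ⟨hFst, hSnd⟩ := thetaChar_J a b
  refine ⟨Λ₀ * s * cexp (π * I * thetaTransformPhase (Matrix.J (Fin 2) ℤ) a b), fun τ u => ?_⟩
  have hτ0 : (τ : ℂ) ≠ 0 := UpperHalfPlane.ne_zero τ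
  have hZ := hP τ τ.im_pos
  obtain ⟨C, -, hCv⟩ := exists_riemannThetaChar_transform hM hZ a b
  obtain ⟨C₀, -, hC₀⟩ := exists_riemannThetaChar_transform hM hZ 0 0
  have hCC₀ := riemannThetaChar_transform_const_eq hM hZ a b hCv hC₀
  have hC₀' := hpin τ τ.im_pos C₀ hC₀
  obtain ⟨hden, h21, hmoeb⟩ := denom_moeb_J (g := 2) ((τ : ℂ) • Q)
  -- the inverse of `τ·Q` is `τ⁻¹·P`
  have hinv : ((τ : ℂ) • Q)⁻¹ = (τ : ℂ)⁻¹ • Pc := by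
    refine Matrix.inv_eq_right_inv ?_
    rw [Matrix.smul_mul, Matrix.mul_smul, hQP, smul_smul, mul_inv_cancel₀ hτ0, one_smul]
  have hsymQ : ((τ : ℂ) • Q).IsSymm := (hP's.map _).smul _
  have htinv : ((τ : ℂ) • Q)ᵀ⁻¹ = (τ : ℂ)⁻¹ • Pc := by rw [hsymQ.eq, hinv]
  -- the law in `v`
  have hlaw : ∀ v : Fin 2 → ℂ,
      riemannThetaChar (-b) a ((-((τ : ℂ)⁻¹)) • Pc) (((τ : ℂ)⁻¹ • Pc) *ᵥ v) =
        C * cexp (π * I * (v ⬝ᵥ ((((τ : ℂ)⁻¹ • Pc) * 1) *ᵥ v))) *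
          riemannThetaChar a b ((τ : ℂ) • Q) v := by
    intro v
    have h := hCv v
    rw [hFst, hSnd, hmoeb, hden, h21, htinv, hinv, ← neg_smul] at h
    exact h
  -- differentiability at `0`
  have hneg : 0 < (-((τ : ℂ)⁻¹)).im := by
    have := UpperHalfPlane.im_inv_neg_coe_pos τ
    rwa [inv_neg] at this
  have hd₁ : DifferentiableAt ℂ (riemannThetaChar a b ((τ : ℂ) • Q)) 0 := by
    obtain ⟨hsym, c, hc, hY⟩ := line_hyps hP's hP'pos τ.im_pos
    exact (differentiable_riemannThetaChar _ hsym hc hY a b) 0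
  have hd₂ : DifferentiableAt ℂ (riemannThetaChar (-b) a ((-((τ : ℂ)⁻¹)) • Pc)) 0 := by
    obtain ⟨hsym, c, hc, hY⟩ := line_hyps hPs hPpos hneg
    exact (differentiable_riemannThetaChar _ hsym hc hY (-b) a) 0
  have key := fderiv_comp_mulVec_eq_of_law hd₁ ((τ : ℂ)⁻¹ • Pc) hd₂ _ hlaw (((τ : ℂ) • Q) *ᵥ u)
  -- `(τ⁻¹ P)(τ Q u) = u`
  have hdetZ : IsUnit ((τ : ℂ) • Q).det := by
    rw [Matrix.det_smul, Fintype.card_fin, hQdef, ← Rat.cast_det]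
    exact (mul_ne_zero (pow_ne_zero _ hτ0) (by exact_mod_cast hdetpos.ne')).isUnit
  have hid : ((τ : ℂ)⁻¹ • Pc) *ᵥ (((τ : ℂ) • Q) *ᵥ u) = u := by
    rw [Matrix.mulVec_mulVec, ← hinv, Matrix.nonsing_inv_mul _ hdetZ, Matrix.one_mulVec]
  rw [hid] at key
  rw [key, hCC₀, hC₀', hℓ]
  simp only
  rw [Matrix.smul_mulVec, ContinuousLinearMap.map_smul, smul_eq_mul]
  ring

end Summit.BirchSwinnertonDyer.BirchSwinnertonDyer.Theorems.HeckeTheta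

end
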